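import Mathlib
import HarnessLib
import Literature.MathematicalPhysics.StatisticalMechanics.WeightTower
import Literature.MathematicalPhysics.StatisticalMechanics.GradientFieldNorms
import Literature.MathematicalPhysics.StatisticalMechanics.DiscreteTaylorFields
import Literature.MathematicalPhysics.StatisticalMechanics.TaylorPolynomialNorms

/-!
# The weights `w_k^X`, `w_{k:k+1}^X` are local for the field gauge of a box containing their locality
# set, and the elementary properties of `w_{k:k+1}^X` used in Lemma 10.3 of [ABKM19]

The weights of [ABKM19] Ch. 7 are `e^{½(φ, A φ)}` for forms `A` that are local on `X^{++}`
(Lemma 7.5 (iii), `WeightData.Local`): `Aφ = 0` when `φ` is constant on the locality set.  The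
Taylor norms `|·|_{k,X,T_φ}` see the field only through the gauge `T = fieldGauge 𝔥 R p S`
(`S = X*`): two fields with the same gauge have the same gradients on `S`, hence differ by a
constant on `S` when `S` is a BOX (`S = {x : InBox a ρ' x}`), hence give the same weight.

* `sub_eq_const_of_fieldGauge_eq` — `T_Sφ = T_Sψ` on a box `S` ⇒ `φ − ψ` is constant on `S`;
* `mulVec_eq_of_fieldGauge_eq`, `quadForm_eq_of_fieldGauge_eq` — for a symmetric `S'`-local form,
  `S' ⊆ S`;
* **`isGaugeLocal_weight`, `isGaugeLocal_midWeight`** — the weights are `T_S`-local;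
* `midWeight_zero`, `one_le_midWeight`, `midWeight_smul_le` (`w(tφ) ≤ w(φ)` for `t ∈ [0,1]`) — the
  regulator properties required by `LinearisedMapSingleBlock.tayNorm_Pi2Rem_le_weighted`.

Everything here is proved; no named fact.

## References
* S. Adams, S. Buchholz, R. Kotecký, S. Müller, arXiv:1910.13564, Lemma 7.5 (iii), Ch. 6.4 (remark
  after (6.46)), Lemma 10.3 [AdamsBuchholzKoteckyMuller2019].
-/

noncomputable section

namespace Literature.MathematicalPhysics.StatisticalMechanics.GradientRG

open Finset Matrix

variable {d M : ℕ} [NeZero M]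

/-! ## Equal gauges on a box: the fields differ by a constant -/

/-- **`T_Sφ = T_Sψ` on a box `S = a + [0,ρ']^d` forces `φ − ψ` to be constant on `S`**
(`p ≥ 1`: the gauge contains the gradients; telescoping along monotone lattice paths from `a`).
[cite: AdamsBuchholzKoteckyMuller2019, Ch. 6.4 (remark after (6.46))] -/
theorem sub_eq_const_of_fieldGauge_eq {a : Fin d → ZMod M} {ρ' p : ℕ} {S : Finset (Fin d → ZMod M)}
    (hS : ∀ x, x ∈ S ↔ InBox a ρ' x) {𝔥 R : ℝ} (h𝔥 : 0 < 𝔥) (hR : 0 < R) (hp : 1 ≤ p)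
    {φ ψ : (Fin d → ZMod M) → ℝ} (h : fieldGauge 𝔥 R p S φ = fieldGauge 𝔥 R p S ψ) :
    ∀ x ∈ S, φ x - ψ x = φ a - ψ a := by
  set g : (Fin d → ZMod M) → ℝ := fun x => (φ x - ψ x) - (φ a - ψ a) with hg
  have h0 : g a = 0 := by simp [hg]
  have hstep : ∀ y, InBox a ρ' y → ∀ i, InBox a ρ' (y + Pi.single i 1) →
      |GradientFRD.fwdDiff i g y| ≤ 0 := by
    intro y hy i _
    have hyS : y ∈ S := (hS y).2 hy
    have hgrad := isGaugeLocal_comp_gradAt (𝔸 := ℝ) h𝔥 hR hp hyS (fun v : Fin d → ℝ => v i) φ ψ h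
    simp only [gradAt_apply] at hgrad
    have : GradientFRD.fwdDiff i g y = GradientFRD.fwdDiff i φ y - GradientFRD.fwdDiff i ψ y := by
      simp only [hg, GradientFRD.fwdDiff]; ring
    rw [this, hgrad, sub_self, abs_zero]
  intro x hx
  have := abs_le_of_fwdDiff_le le_rfl h0 hstep x ((hS x).1 hx)
  rw [zero_mul] at this
  have hgx : g x = 0 := abs_nonpos_iff.1 this
  simp only [hg] at hgx
  linarith

/-- A symmetric form local on `S' ⊆ S` (box) acts equally on fields with the same gauge.
[cite: AdamsBuchholzKoteckyMuller2019, Lemma 7.5 (iii)] -/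
theorem mulVec_eq_of_fieldGauge_eq {a : Fin d → ZMod M} {ρ' p : ℕ} {S S' : Finset (Fin d → ZMod M)}
    (hS : ∀ x, x ∈ S ↔ InBox a ρ' x) (hS'S : S' ⊆ S) {𝔥 R : ℝ} (h𝔥 : 0 < 𝔥) (hR : 0 < R) (hp : 1 ≤ p)
    {A : Matrix (Fin d → ZMod M) (Fin d → ZMod M) ℝ} (hA : IsGradLocal A S')
    {φ ψ : (Fin d → ZMod M) → ℝ} (h : fieldGauge 𝔥 R p S φ = fieldGauge 𝔥 R p S ψ) :
    A *ᵥ φ = A *ᵥ ψ := by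
  have hc := sub_eq_const_of_fieldGauge_eq hS h𝔥 hR hp h
  have hd : A *ᵥ (φ - ψ) = 0 := hA (φ - ψ) fun x hx y hy => by
    rw [Pi.sub_apply, Pi.sub_apply, hc x (hS'S hx), hc y (hS'S hy)]
  rwa [Matrix.mulVec_sub, sub_eq_zero] at hd

/-- **The quadratic form of a symmetric `S'`-local matrix is `T_S`-local** (`S' ⊆ S` a box).
[cite: AdamsBuchholzKoteckyMuller2019, Lemma 7.5 (iii)] -/
theorem quadForm_eq_of_fieldGauge_eq {a : Fin d → ZMod M} {ρ' p : ℕ} {S S' : Finset (Fin d → ZMod M)}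
    (hS : ∀ x, x ∈ S ↔ InBox a ρ' x) (hS'S : S' ⊆ S) {𝔥 R : ℝ} (h𝔥 : 0 < 𝔥) (hR : 0 < R) (hp : 1 ≤ p)
    {A : Matrix (Fin d → ZMod M) (Fin d → ZMod M) ℝ} (hA : IsGradLocal A S') (hAs : A.IsSymm)
    {φ ψ : (Fin d → ZMod M) → ℝ} (h : fieldGauge 𝔥 R p S φ = fieldGauge 𝔥 R p S ψ) :
    φ ⬝ᵥ A *ᵥ φ = ψ ⬝ᵥ A *ᵥ ψ := by
  have h1 := mulVec_eq_of_fieldGauge_eq hS hS'S h𝔥 hR hp hA h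
  have hAt : Aᵀ = A := hAs
  have h2 : φ ⬝ᵥ A *ᵥ ψ = ψ ⬝ᵥ A *ᵥ ψ := by
    rw [Matrix.dotProduct_mulVec φ A ψ, Matrix.dotProduct_mulVec ψ A ψ, ← Matrix.mulVec_transpose,
      ← Matrix.mulVec_transpose, hAt, h1]
  rw [h1, h2]

/-! ## The weights are gauge-local -/

namespace WeightData

variable {W : WeightData (Fin d → ZMod M)}

/-- **`w_k^X` is `T_S`-local** for every box `S ⊇ X^{++}_k`. [cite: AdamsBuchholzKoteckyMuller2019, Lemma 7.5 (iii)] -/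
theorem isGaugeLocal_weight {nb : ℕ → Finset (Fin d → ZMod M) → Finset (Fin d → ZMod M)}
    (hL : W.Local nb) {D : ℕ → Matrix (Fin d → ZMod M) (Fin d → ZMod M) ℝ} (hD : W.Dominated D)
    {a : Fin d → ZMod M} {ρ' p : ℕ} {S : Finset (Fin d → ZMod M)} (hS : ∀ x, x ∈ S ↔ InBox a ρ' x)
    {𝔥 R : ℝ} (h𝔥 : 0 < 𝔥) (hR : 0 < R) (hp : 1 ≤ p) {k : ℕ} {X : Finset (Fin d → ZMod M)}
    (hnb : nb k X ⊆ S) : IsGaugeLocal (fieldGauge 𝔥 R p S) (W.weight k X) := by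
  intro φ ψ h
  rw [weight, weight, quadForm_eq_of_fieldGauge_eq hS hnb h𝔥 hR hp (form_isGradLocal hL k X)
    (form_isSymm hD k X) h]

/-- **`w_{k:k+1}^X` is `T_S`-local** for every box `S ⊇ X^{++}_k`. [cite: AdamsBuchholzKoteckyMuller2019, Lemma 7.5 (iii)] -/
theorem isGaugeLocal_midWeight {nb : ℕ → Finset (Fin d → ZMod M) → Finset (Fin d → ZMod M)}
    (hL : W.Local nb) {D : ℕ → Matrix (Fin d → ZMod M) (Fin d → ZMod M) ℝ} (hD : W.Dominated D)
    {a : Fin d → ZMod M} {ρ' p : ℕ} {S : Finset (Fin d → ZMod M)} (hS : ∀ x, x ∈ S ↔ InBox a ρ' x)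
    {𝔥 R : ℝ} (h𝔥 : 0 < 𝔥) (hR : 0 < R) (hp : 1 ≤ p) {k : ℕ} {X : Finset (Fin d → ZMod M)}
    (hnb : nb k X ⊆ S) : IsGaugeLocal (fieldGauge 𝔥 R p S) (W.midWeight k X) := by
  intro φ ψ h
  rw [midWeight, midWeight, quadForm_eq_of_fieldGauge_eq hS hnb h𝔥 hR hp (midForm_isGradLocal hL k X)
    (midForm_isSymm hD k X) h]

/-! ## Regulator properties of `w_{k:k+1}^X` -/

/-- `w_{k:k+1}^X(0) = 1`. [cite: AdamsBuchholzKoteckyMuller2019, Ch. 7.1 (7.4)] -/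
@[simp] theorem midWeight_zero (k : ℕ) (X : Finset (Fin d → ZMod M)) : W.midWeight k X 0 = 1 := by
  simp [midWeight]

/-- `w_k^X(0) = 1`. [cite: AdamsBuchholzKoteckyMuller2019, Ch. 7.1 (7.4)] -/
@[simp] theorem weight_zero' (k : ℕ) (X : Finset (Fin d → ZMod M)) : W.weight k X 0 = 1 := by
  simp [weight]

/-- `1 ≤ w_{k:k+1}^X(φ)`. [cite: AdamsBuchholzKoteckyMuller2019, Lemma 7.5 (i)] -/
theorem one_le_midWeight {D : ℕ → Matrix (Fin d → ZMod M) (Fin d → ZMod M) ℝ} (h : W.Dominated D)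
    (k : ℕ) (X : Finset (Fin d → ZMod M)) (φ : (Fin d → ZMod M) → ℝ) : 1 ≤ W.midWeight k X φ := by
  have h0 := (midForm_posSemidef h k X).dotProduct_mulVec_nonneg φ
  rw [star_trivial] at h0
  exact Real.one_le_exp (by positivity)

/-- **Monotone along rays**: `w_{k:k+1}^X(tφ) ≤ w_{k:k+1}^X(φ)` for `t ∈ [0,1]` (the form is
non-negative). [cite: AdamsBuchholzKoteckyMuller2019, Lemma 10.3 ("monotonicity of t ↦ w_{k:k+1}(tφ)")] -/
theorem midWeight_smul_le {D : ℕ → Matrix (Fin d → ZMod M) (Fin d → ZMod M) ℝ} (h : W.Dominated D)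
    (k : ℕ) (X : Finset (Fin d → ZMod M)) (φ : (Fin d → ZMod M) → ℝ) {t : ℝ}
    (ht : t ∈ Set.Icc (0 : ℝ) 1) : W.midWeight k X (t • φ) ≤ W.midWeight k X φ := by
  have h0 := (midForm_posSemidef h k X).dotProduct_mulVec_nonneg φ
  rw [star_trivial] at h0
  rw [midWeight, midWeight, Matrix.mulVec_smul, dotProduct_smul, smul_dotProduct, smul_eq_mul, smul_eq_mul]
  apply Real.exp_le_exp.2
  have ht2 : t * t ≤ 1 := by nlinarith [ht.1, ht.2]
  nlinarith

end WeightData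

end Literature.MathematicalPhysics.StatisticalMechanics.GradientRG

end
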